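import Mathlib
import Summits.Ventures.PercRepro2.Defs
import Summits.Ventures.PercRepro2.Independence
import Summits.Ventures.PercRepro2.Harris
import Summits.Ventures.PercRepro2.Graph
import Summits.Ventures.PercRepro2.Events
import Summits.Ventures.PercRepro2.ZCClusterBlind
import Summits.Ventures.PercRepro2.ZCRootDecomp
import Summits.Ventures.PercRepro2.ZCCondProb
import Summits.Ventures.PercRepro2.ZCThetaPA
import Summits.Ventures.PercRepro2.CondAvoidPA
import Summits.Ventures.PercRepro2.ZCDirectCube
import Summits.Ventures.PercRepro2.ZCDirectFibre
import Summits.Ventures.PercRepro2.ZCDirectInfluence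

/-!
# `(ZC-direct)` for functions: the lift of an observable of the root edges, its tower identities and
the fibre step (blind cell PercRepro2, mine-a g29)

`liftU u ω = u (ω restricted to the edges of a₁)`; `E[liftU u · 1_A]` is the `σ₁`-average of the fibre
expectations (`expect_liftU_mul_indicator`), `E[liftU u] = E[u]` (`expect_liftU`), and the fibre step
`fibre_step_fun` (`ZCDirectCube.cube_step` applied to `u` against the fibres of `{a₁ ↔ a₃}`, `{a₁ ↔ o}`).
-/

namespace Summit.Ventures.PercRepro2

namespace ZCDirect

variable {V : Type*} {E : Type*} [Fintype V] [DecidableEq V] [Fintype E] [DecidableEq E]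
  {R : Type*} [Field R] [LinearOrder R] [IsStrictOrderedRing R]

variable (ends : E → Sym2 V) (a₁ : V)

section Lift

variable (p : E → R)

/-- The lift of an observable of the edges of `a₁` to the whole configuration space. -/
def liftU (u : ({e // e ∉ awayEdges ends a₁} → Bool) → R) : Config E → R :=
  fun ω => u (fun i => ω i)

omit [Fintype E] [DecidableEq E] [Field R] [LinearOrder R] [IsStrictOrderedRing R] in
/-- The lift evaluated on a glued configuration. -/
lemma liftU_glue (u : ({e // e ∉ awayEdges ends a₁} → Bool) → R)
    (σ₁ : {e // e ∈ awayEdges ends a₁} → Bool) (τ : {e // e ∉ awayEdges ends a₁} → Bool) :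
    liftU ends a₁ u (glue (awayEdges ends a₁) σ₁ τ) = u τ := by
  unfold liftU
  congr 1
  funext i
  exact glue_apply_of_notMem _ _ _ i.2

omit [LinearOrder R] [IsStrictOrderedRing R] in
/-- Tower identity for the lift against an event. -/
lemma expect_liftU_mul_indicator (u : ({e // e ∉ awayEdges ends a₁} → Bool) → R)
    (A : Set (Config E)) :
    expect p (fun ω => liftU ends a₁ u ω * A.indicator 1 ω) =
      ∑ σ₁ : {e // e ∈ awayEdges ends a₁} → Bool,
        weight (fun i : {e // e ∈ awayEdges ends a₁} => p i) σ₁ *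
          expect (fun i : {e // e ∉ awayEdges ends a₁} => p i)
            (fun τ => u τ * (fib ends a₁ A σ₁).indicator 1 τ) := by
  rw [expect_eq_sum_fib ends a₁ p]
  refine Finset.sum_congr rfl fun σ₁ _ => ?_
  congr 1
  unfold expect
  refine Finset.sum_congr rfl fun τ _ => ?_
  show weight _ τ * (liftU ends a₁ u (glue (awayEdges ends a₁) σ₁ τ) *
      A.indicator 1 (glue (awayEdges ends a₁) σ₁ τ)) = weight _ τ * (u τ * (fib ends a₁ A σ₁).indicator 1 τ)
  rw [liftU_glue]
  rfl

omit [LinearOrder R] [IsStrictOrderedRing R] in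
/-- The expectation of the lift is the expectation over the edges of `a₁`. -/
lemma expect_liftU (u : ({e // e ∉ awayEdges ends a₁} → Bool) → R) :
    expect p (liftU ends a₁ u) = expect (fun i : {e // e ∉ awayEdges ends a₁} => p i) u := by
  rw [expect_eq_sum_fib ends a₁ p]
  simp_rw [liftU_glue]
  rw [← Finset.sum_mul, sum_weight_away, one_mul]

/-- **The fibre step for functions**: `Φ_u(σ₁) ≥ (S·m(σ₁) − b)·Cov(u, X)`. -/
lemma fibre_step_fun (hp : IsProbVec p) {u : ({e // e ∉ awayEdges ends a₁} → Bool) → R}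
    (hu : Monotone u) (hu0 : ∀ τ, 0 ≤ u τ)
    (σ₁ : {e // e ∈ awayEdges ends a₁} → Bool) {a₃ o : V} (h3 : a₃ ≠ a₁) (ho : o ≠ a₁)
    {S b : R} (hS : 0 ≤ S) :
    let p₂ : {e // e ∉ awayEdges ends a₁} → R := fun i => p i
    let X := fib ends a₁ (connEvent ends a₁ a₃) σ₁
    let W := fib ends a₁ (connEvent ends a₁ o) σ₁
    (S * mConst ends a₁ p σ₁ a₃ o - b) *
        (expect p₂ (fun τ => u τ * X.indicator 1 τ) - expect p₂ u * prob p₂ X) ≤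
      S * (expect p₂ (fun τ => u τ * (X ∩ W).indicator 1 τ) - expect p₂ u * prob p₂ (X ∩ W)) -
        b * (expect p₂ (fun τ => u τ * X.indicator 1 τ) - expect p₂ u * prob p₂ X) := by
  intro p₂ X W
  by_cases hγ : Conn ends (baseConfig ends a₁ σ₁) a₃ o
  · have hXW : X = W := fib_conn_eq_of_conn ends a₁ σ₁ hγ
    have hm : mConst ends a₁ p σ₁ a₃ o = 1 := by simp [mConst, hγ]
    rw [hm, ← hXW, Set.inter_self]
    exact le_of_eq (by ring)
  · have hm : mConst ends a₁ p σ₁ a₃ o = prob p₂ W := by simp [mConst, hγ, p₂, W]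
    rw [hm]
    refine cube_step (S := S) (b := b) (isProbVec_restrict ends a₁ hp) hu hu0
      (isUpperSet_fib ends a₁ (isUpperSet_connEvent ends a₁ a₃) σ₁)
      (isUpperSet_fib ends a₁ (isUpperSet_connEvent ends a₁ o) σ₁) ?_ hS
    exact prob_inter_eq_mul_of_dependsOn p₂ (disjoint_into ends a₁ σ₁ h3 hγ)
      (dependsOn_fib_conn ends a₁ σ₁ h3) (dependsOn_fib_conn ends a₁ σ₁ ho)

end Lift

end ZCDirect

end Summit.Ventures.PercRepro2
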